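import Summits.BirchSwinnertonDyer.BirchSwinnertonDyer.Theses.PrintX8VSC
import Summits.BirchSwinnertonDyer.BirchSwinnertonDyer.Theorems.PrintX8VSCSharpFlatKatoUpperHalfContra
import HarnessLib

/-!
# Route `PrintX8VSC` (print-keyed repair twin of `PrintX8VS`), analytic rank `0`: what the route's two HELD packs
# `PublishedInputsX8Contra` (item 23741) and `HeldInputsX8RContra` (item 23734) buy BY THEMSELVES on the leaf — the UPPER half
# `ord₃ #Ш ≤ ord₃ #Ш_an` on EVERY X8 pair of analytic rank `0` (any `3`-adic image), the unit cells, and the reduction of the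
# rank-zero link's conclusion `Typed.MissingPPartAt W p` to the LOWER half alone — with NO crux (neither K′ 23732, nor C′ 23733,
# nor the print-keyed main conjecture 23742) (cell `bsd-print-x8`, prover seat p2 gen 4; `--supports` 23742; closes nothing)

HONEST FRAMING: plumbing over `Theorems/PrintX8VSCSharpFlatKatoUpperHalfContra.lean` (same seat): the nine named-fact binders of
`X8KatoUpperHalfContra.X8.missingUpperBoundAt_of_sharpFlatKatoContra_of_analyticRank_eq_zero` are conjuncts 1–7 of
`PublishedInputsX8Contra` (`exists_isNewformOf`, `thm22_…`, `thm714_…`, `thm716_…_contra`, `lem59AllN_…`, the period unit at `3`,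
`hasEntireLFunction_rat`) and conjuncts 3–4 of `HeldInputsX8RContra` (the JOINT contragredient Coleman–Kato package
`thm714seq_sharpFlatColemanKato_zetaJoint_contra`, projected to one colour by the PROVED
`thm714seq_sharpFlatColemanKato_zeta_contra_of_joint`, and GZK). THEOREM B enters as a kernel theorem. So, in the route's own currency:
the rank-zero link `RankZeroLinkOfPrintX8Contra` (item 23744, CLOSED from the main conjecture) needs the cruxes ONLY for the LOWER half
`MissingLowerBoundAt W 3` (`ord₃ #Ш_an ≤ ord₃ #Ш`); on the 54 rank-`0` census cells with `3 ∤ #Ш_an` (all `C_ns⁺(3)`; each of the 82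
surj rank-`0` cells of the open census ty3 `x8_records.json` has `3 ∣ #Ш_an` — ERRATUM: the first filing p677290 said «134 … 80 surj +
54») the packs alone give `BSD(E,3)`. Conditional on the HELD packs (published statement-only facts); the cruxes, the leaf X8 and BSD are NOT
proved by any of this. beyond-print theorem: YES (modest; see the helper's module docstring — integral Kato-side bound at
non-surjective image = print + THEOREM B).

References: route file `Theses/PrintX8VSC.lean` (rev 2, items 23734 / 23741 / 23742 / 23744); [Sprung2012] Def. 6.1, Def. 7.11/7.12,
Thm. 7.14 with (3), Thm. 7.16 (pp. 1495–1504), §7.5; [Sprung2024] §5.2 Lemmas 5.5–5.9 (pp. 39–41); [Kato2004Asterisque] Thm. 12.5,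
Thm. 12.6 (p. 222); [Pollack2003] Def. 6.15; [Miller2011LMS] Def. 1.1.
-/

set_option autoImplicit false
-- justification: the mandated namespace `Summit.BirchSwinnertonDyer.BirchSwinnertonDyer.Theorems`
-- (single-conjunct summit, Sub = Summit) repeats a segment by design (D-0017).
set_option linter.dupNamespace false

namespace Summit.BirchSwinnertonDyer.BirchSwinnertonDyer.Theorems.PrintX8VSCUpperHalf

open Literature Literature.NumberTheory.EllipticCurves Literature.NumberTheory.EllipticCurves.Rank1Residual
  Literature.NumberTheory.EllipticCurves.Rank1Residual.Typed Literature.NumberTheory.EllipticCurves.Sprung2012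
open Summit.BirchSwinnertonDyer.BirchSwinnertonDyer.Theses.PrintX8VSC

/-- **The UPPER half on X8 ∩ {r_an = 0}, ANY image, from the two held packs alone** — `PublishedInputsX8Contra →
HeldInputsX8RContra → ∀ X8 pair of analytic rank 0, MissingUpperBoundAt W p` (`ord₃ #Ш ≤ ord₃ #Ш_an`): conjuncts 1–7 of the
published bundle and conjuncts 3 (joint contragredient package, projected to one colour) and 4 (GZK) of the held bundle fed to
`X8KatoUpperHalfContra.X8.missingUpperBoundAt_of_sharpFlatKatoContra_of_analyticRank_eq_zero`. No crux is consumed. Conditional on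
the packs; closes nothing. [cite: Sprung2012, Def. 7.11/7.12 (p. 1503), Thm. 7.14 with (3) and Thm. 7.16 (p. 1504)]
[cite: Sprung2024, §5.2 Lemmas 5.5–5.9 (pp. 39–41)] [cite: Kato2004Asterisque, Thm. 12.5 and Thm. 12.6 (p. 222)] [cite: Miller2011LMS, Def. 1.1] -/
theorem upperHalf_rankZero_of_publishedInputs_of_heldInputs (hPub : PublishedInputsX8Contra) (hHeld : HeldInputsX8RContra) :
    ∀ (W : WeierstrassCurve ℚ) [W.IsElliptic] [W.IsGloballyMinimal] (p : ℕ) [Fact p.Prime],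
      ClassX8 W p → W.analyticRank = 0 → MissingUpperBoundAt W p := by
  obtain ⟨hmodf, h22, h714, h716c, h59, h3, hmod⟩ := hPub
  obtain ⟨-, -, hJc, hGZK, -, -⟩ := hHeld
  exact X8KatoUpperHalfContra.X8.upperHalf_rankZero_of_sharpFlatFactsContra hmodf h22 h714 h716c
    (thm714seq_sharpFlatColemanKato_zeta_contra_of_joint hJc) h59 h3 hGZK hmod

/-- **UNIT CELLS from the two held packs alone** — on every X8 pair of analytic rank `0` with `ord₃ #Ш_an ≤ 0` (54 of the 142 rank-`0`
census cells), `BSD(E,3)`; no crux consumed. Conditional on the packs; closes nothing.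
[cite: Sprung2012, Thm. 7.14 and Thm. 7.16 (p. 1504)] [cite: Sprung2024, §5.2 Lemmas 5.5–5.9] [cite: Miller2011LMS, §1 and Def. 1.1] -/
theorem bsdp_rankZero_shaUnit_of_publishedInputs_of_heldInputs (hPub : PublishedInputsX8Contra) (hHeld : HeldInputsX8RContra) :
    ∀ (W : WeierstrassCurve ℚ) [W.IsElliptic] [W.IsGloballyMinimal] (p : ℕ) [Fact p.Prime],
      ClassX8 W p → W.analyticRank = 0 → (∃ q : ℚ, shaAn W = (q : ℂ) ∧ padicValRat p q ≤ 0) → BSDp W p := by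
  obtain ⟨hmodf, h22, h714, h716c, h59, h3, hmod⟩ := hPub
  obtain ⟨-, -, hJc, hGZK, -, -⟩ := hHeld
  exact X8KatoUpperHalfContra.X8.bsdp_rankZero_shaUnit_of_sharpFlatFactsContra hmodf h22 h714 h716c
    (thm714seq_sharpFlatColemanKato_zeta_contra_of_joint hJc) h59 h3 hGZK hmod

/-- **At analytic rank `0` the rank-zero link's conclusion reduces to the LOWER half, given the packs**: for every X8 pair of analytic
rank `0`, `Typed.MissingPPartAt W p ↔ MissingLowerBoundAt W p` (`ord₃ #Ш_an ≤ ord₃ #Ш`) — i.e. what item 23744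
`RankZeroLinkOfPrintX8Contra` draws from the print-keyed main conjecture (item 23742 ⟸ K′ ∧ C′ by the glue 23743) beyond the packs is
exactly the Eisenstein-side half at the pair. Conditional on the packs; closes nothing.
[cite: Sprung2012, Thm. 7.16 (p. 1504) and Main Conj. 7.21 (p. 1505)] [cite: Miller2011LMS, Def. 1.1] -/
theorem missingPPartAt_iff_missingLowerBoundAt_rankZero_of_publishedInputs_of_heldInputs
    (hPub : PublishedInputsX8Contra) (hHeld : HeldInputsX8RContra)
    (W : WeierstrassCurve ℚ) [W.IsElliptic] [W.IsGloballyMinimal] (p : ℕ) [Fact p.Prime]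
    (hX : ClassX8 W p) (h0 : W.analyticRank = 0) :
    MissingPPartAt W p ↔ MissingLowerBoundAt W p :=
  ⟨fun h ↦ (lower_and_upper_of_missingPPartAt W p h).1,
    fun hl ↦ missingPPartAt_of_lower_of_upper W p hl
      (upperHalf_rankZero_of_publishedInputs_of_heldInputs hPub hHeld W p hX h0)⟩

end Summit.BirchSwinnertonDyer.BirchSwinnertonDyer.Theorems.PrintX8VSCUpperHalf
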